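import Summits.AtomisticToContinuum.FouriersLaw.Theorems.EmbeddedDrudeMourreDrudeDissolutionStubPencilDerivationAlgebra
import Summits.AtomisticToContinuum.FouriersLaw.Theorems.EmbeddedDrudeMourreDrudeDissolutionStubPolynomialStationarity

/-!
# Stub F `stub_pencilFramework` of line `gram-pencil-harmonic-chaos`, part F-P: the algebra `𝒫` of
local polynomial observables — symmetries, locality, polynomial Lipschitz moduli, moments
(crux `EmbeddedDrudeMourre.DrudeDissolution`, stmt-AtomisticToContinuum-12593; `--supports` file)

`𝒫 := Algebra.adjoin ℝ {σ ↦ q_x, σ ↦ p_x}` (spelled out in full, as in the registered stub). The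
rich zero-wavenumber datum of stub F has observables `span{u ∘ φ_s : u ∈ 𝒫}`; its construction
(parts F-b, F-c) needs, for every `u ∈ 𝒫`, the bookkeeping proved here by structural induction on
`Algebra.adjoin`:

* `comp_mem_polyObs_of_coord` and its instances: `𝒫` is stable under precomposition with the
  translations `τ_x`, the momentum reversal `R` and the spatial reflection `ι σ = σ(−·)`;
* `bondCurrentZ_mem_polyObs`, `energyDensityZ_mem_polyObs`: `j₀, h₀ ∈ 𝒫` for `pinnedChain`;
* `pencilFramework_polynomials` (registered helper): every `u ∈ 𝒫` reads a box `[-k, k]` and is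
  polynomially Lipschitz there with a polynomial growth bound —
  `|u σ - u σ'| ≤ C R^d δ`, `|u σ'| ≤ C R^d` whenever the coordinates of `σ'` on `[-k, k]` are
  bounded by `R ≥ 1` and those of `σ` are within `δ ≤ 1` of them (the hypothesis `ha` of the
  fixed-time locality lemmas, parts F-L1/F-L2);
* `continuous_comp_flow_of_mem_polyObs`: `t ↦ u(φ_t σ)` is continuous on the carrier;
* `moments_of_mem_polyObs`: under a shift-invariant DLR state of `pinnedChain` (`ω₂ > 0`,
  `lam, β ≥ 0`, `T > 0`) every `u ∈ 𝒫` is measurable, in `L²`, with `u⁴ ∈ L¹` (from the sibling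
  stub S's `measurable_and_integrable_pow_of_mem_polyObs`).
-/

noncomputable section

namespace Summit.AtomisticToContinuum.FouriersLaw.Theorems.DrudeDissolution.GramPencilHarmonicChaos

open MeasureTheory Filter Set Function Topology
open scoped InnerProductSpace ENNReal
open Literature.MathematicalPhysics.KineticTheory
open Literature.MathematicalPhysics.KineticTheory.HeatConduction

/-! ## Symmetries of `𝒫` -/

/-- **`𝒫` is stable under precomposition with any map whose coordinate pull-backs are local
polynomials** (precomposition is an algebra homomorphism). [folklore] -/
theorem comp_mem_polyObs_of_coord (g : ChainConfig → ChainConfig)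
    (hg : ∀ xc : ℤ × Bool, ((fun σ : ChainConfig => if xc.2 then (σ xc.1).2 else (σ xc.1).1) ∘ g) ∈
      Algebra.adjoin ℝ (Set.range fun xc : ℤ × Bool => fun σ : ChainConfig =>
        if xc.2 then (σ xc.1).2 else (σ xc.1).1))
    {u : ChainConfig → ℝ}
    (hu : u ∈ Algebra.adjoin ℝ (Set.range fun xc : ℤ × Bool => fun σ : ChainConfig =>
      if xc.2 then (σ xc.1).2 else (σ xc.1).1)) :
    u ∘ g ∈ Algebra.adjoin ℝ (Set.range fun xc : ℤ × Bool => fun σ : ChainConfig =>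
      if xc.2 then (σ xc.1).2 else (σ xc.1).1) := by
  induction hu using Algebra.adjoin_induction with
  | mem f hf =>
    obtain ⟨xc, rfl⟩ := hf
    exact hg xc
  | algebraMap r => exact Subalgebra.algebraMap_mem _ r
  | add f₁ f₂ _ _ ih₁ ih₂ => exact add_mem ih₁ ih₂
  | mul f₁ f₂ _ _ ih₁ ih₂ => exact mul_mem ih₁ ih₂

/-- `𝒫` is translation stable: `u ∘ τ_y ∈ 𝒫`. [folklore] -/
theorem comp_chainShift_mem_polyObs (y : ℤ) {u : ChainConfig → ℝ}
    (hu : u ∈ Algebra.adjoin ℝ (Set.range fun xc : ℤ × Bool => fun σ : ChainConfig =>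
      if xc.2 then (σ xc.1).2 else (σ xc.1).1)) :
    u ∘ chainShift y ∈ Algebra.adjoin ℝ (Set.range fun xc : ℤ × Bool => fun σ : ChainConfig =>
      if xc.2 then (σ xc.1).2 else (σ xc.1).1) := by
  refine comp_mem_polyObs_of_coord (chainShift y) (fun xc => ?_) hu
  have e : ((fun σ : ChainConfig => if xc.2 then (σ xc.1).2 else (σ xc.1).1) ∘ chainShift y) =
      fun σ : ChainConfig => if xc.2 then (σ (xc.1 + y)).2 else (σ (xc.1 + y)).1 := by
    funext σ
    simp only [comp_apply, chainShift_apply]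
  rw [e]
  exact Algebra.subset_adjoin ⟨(xc.1 + y, xc.2), rfl⟩

/-- `𝒫` is stable under the momentum reversal: `u ∘ R ∈ 𝒫`. [folklore] -/
theorem comp_chainReversal_mem_polyObs {u : ChainConfig → ℝ}
    (hu : u ∈ Algebra.adjoin ℝ (Set.range fun xc : ℤ × Bool => fun σ : ChainConfig =>
      if xc.2 then (σ xc.1).2 else (σ xc.1).1)) :
    u ∘ chainReversal ∈ Algebra.adjoin ℝ (Set.range fun xc : ℤ × Bool => fun σ : ChainConfig =>
      if xc.2 then (σ xc.1).2 else (σ xc.1).1) := by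
  refine comp_mem_polyObs_of_coord chainReversal (fun xc => ?_) hu
  obtain ⟨x, b⟩ := xc
  cases b
  · have e : ((fun σ : ChainConfig => if (x, false).2 then (σ (x, false).1).2 else (σ (x, false).1).1) ∘
        chainReversal) = fun σ : ChainConfig => (σ x).1 := by
      funext σ
      simp only [comp_apply, chainReversal_apply, Bool.false_eq_true, if_false]
    rw [e]
    exact position_mem_localPolynomials x
  · have e : ((fun σ : ChainConfig => if (x, true).2 then (σ (x, true).1).2 else (σ (x, true).1).1) ∘
        chainReversal) = -fun σ : ChainConfig => (σ x).2 := by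
      funext σ
      simp only [comp_apply, chainReversal_apply, if_true, Pi.neg_apply]
    rw [e]
    exact neg_mem (momentum_mem_localPolynomials x)

/-- `𝒫` is stable under the spatial reflection `ι σ = σ(−·)`: `u ∘ ι ∈ 𝒫`. [folklore] -/
theorem comp_reflect_mem_polyObs {u : ChainConfig → ℝ}
    (hu : u ∈ Algebra.adjoin ℝ (Set.range fun xc : ℤ × Bool => fun σ : ChainConfig =>
      if xc.2 then (σ xc.1).2 else (σ xc.1).1)) :
    (u ∘ fun (σ : ChainConfig) (i : ℤ) => σ (-i)) ∈ Algebra.adjoin ℝ (Set.range fun xc : ℤ × Bool =>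
      fun σ : ChainConfig => if xc.2 then (σ xc.1).2 else (σ xc.1).1) := by
  refine comp_mem_polyObs_of_coord (fun (σ : ChainConfig) (i : ℤ) => σ (-i)) (fun xc => ?_) hu
  have e : ((fun σ : ChainConfig => if xc.2 then (σ xc.1).2 else (σ xc.1).1) ∘
      fun (σ : ChainConfig) (i : ℤ) => σ (-i)) =
      fun σ : ChainConfig => if xc.2 then (σ (-xc.1)).2 else (σ (-xc.1)).1 := by
    funext σ
    simp only [comp_apply]
  rw [e]
  exact Algebra.subset_adjoin ⟨(-xc.1, xc.2), rfl⟩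

/-! ## The generators `j₀`, `h₀` of the chain are local polynomials -/

/-- **The bond current of `pinnedChain` is a local polynomial**:
`j₀ = -(p₀ + p₁)/2 · (r + β r³)`, `r = q₁ - q₀`. [folklore] -/
theorem bondCurrentZ_mem_polyObs (ω₂ lam β γ : ℝ) :
    (fun σ : ChainConfig => (pinnedChain ω₂ lam β γ).bondCurrentZ σ 0) ∈
      Algebra.adjoin ℝ (Set.range fun xc : ℤ × Bool => fun σ : ChainConfig =>
        if xc.2 then (σ xc.1).2 else (σ xc.1).1) := by
  set Q : ℤ → ChainConfig → ℝ := fun z σ => (σ z).1 with hQ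
  set Pm : ℤ → ChainConfig → ℝ := fun z σ => (σ z).2 with hPm
  have hF : (fun σ : ChainConfig => (pinnedChain ω₂ lam β γ).bondCurrentZ σ 0) =
      -(((1 / 2 : ℝ) • (Pm 0 + Pm 1)) * ((Q 1 - Q 0) + β • (Q 1 - Q 0) ^ 3)) := by
    funext σ
    simp only [hQ, hPm, Pi.add_apply, Pi.sub_apply, Pi.neg_apply, Pi.smul_apply, Pi.pow_apply,
      Pi.mul_apply, smul_eq_mul, OscillatorChain.bondCurrentZ, pinnedChain_deriv_V_eq, zero_add]
    ring
  rw [hF]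
  refine neg_mem (mul_mem (Subalgebra.smul_mem _ (add_mem (momentum_mem_localPolynomials 0)
    (momentum_mem_localPolynomials 1)) _) (add_mem (sub_mem (position_mem_localPolynomials 1)
    (position_mem_localPolynomials 0)) (Subalgebra.smul_mem _ (pow_mem (sub_mem
    (position_mem_localPolynomials 1) (position_mem_localPolynomials 0)) 3) _)))

/-- **The energy density of `pinnedChain` is a local polynomial**:
`h₀ = p₀²/2 + ω₂q₀²/2 + lam q₀⁴/4 + [V(q₁ - q₀) + V(q₀ - q₋₁)]/2`, `V(r) = r²/2 + βr⁴/4`. [folklore] -/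
theorem energyDensityZ_mem_polyObs (ω₂ lam β γ : ℝ) :
    (fun σ : ChainConfig => (pinnedChain ω₂ lam β γ).energyDensityZ σ 0) ∈
      Algebra.adjoin ℝ (Set.range fun xc : ℤ × Bool => fun σ : ChainConfig =>
        if xc.2 then (σ xc.1).2 else (σ xc.1).1) := by
  set Q : ℤ → ChainConfig → ℝ := fun z σ => (σ z).1 with hQ
  set Pm : ℤ → ChainConfig → ℝ := fun z σ => (σ z).2 with hPm
  have hF : (fun σ : ChainConfig => (pinnedChain ω₂ lam β γ).energyDensityZ σ 0) =
      (1 / 2 : ℝ) • Pm 0 ^ 2 + ((ω₂ / 2) • Q 0 ^ 2 + (lam / 4) • Q 0 ^ 4) +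
        (1 / 2 : ℝ) • (((1 / 2 : ℝ) • (Q 1 - Q 0) ^ 2 + (β / 4) • (Q 1 - Q 0) ^ 4) +
          ((1 / 2 : ℝ) • (Q 0 - Q (-1)) ^ 2 + (β / 4) • (Q 0 - Q (-1)) ^ 4)) := by
    funext σ
    simp only [hQ, hPm, Pi.add_apply, Pi.sub_apply, Pi.smul_apply, Pi.pow_apply, smul_eq_mul,
      OscillatorChain.energyDensityZ, zero_add, zero_sub]
    show (σ 0).2 ^ 2 / 2 + (ω₂ * (σ 0).1 ^ 2 / 2 + lam * (σ 0).1 ^ 4 / 4) +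
        ((((σ 1).1 - (σ 0).1) ^ 2 / 2 + β * ((σ 1).1 - (σ 0).1) ^ 4 / 4) +
          (((σ 0).1 - (σ (-1)).1) ^ 2 / 2 + β * ((σ 0).1 - (σ (-1)).1) ^ 4 / 4)) / 2 = _
    ring
  rw [hF]
  have hq : ∀ z, Q z ∈ Algebra.adjoin ℝ (Set.range fun xc : ℤ × Bool => fun σ : ChainConfig =>
      if xc.2 then (σ xc.1).2 else (σ xc.1).1) := fun z => position_mem_localPolynomials z
  have hp : ∀ z, Pm z ∈ Algebra.adjoin ℝ (Set.range fun xc : ℤ × Bool => fun σ : ChainConfig =>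
      if xc.2 then (σ xc.1).2 else (σ xc.1).1) := fun z => momentum_mem_localPolynomials z
  refine add_mem (add_mem (Subalgebra.smul_mem _ (pow_mem (hp 0) 2) _)
    (add_mem (Subalgebra.smul_mem _ (pow_mem (hq 0) 2) _) (Subalgebra.smul_mem _ (pow_mem (hq 0) 4) _)))
    (Subalgebra.smul_mem _ (add_mem
      (add_mem (Subalgebra.smul_mem _ (pow_mem (sub_mem (hq 1) (hq 0)) 2) _)
        (Subalgebra.smul_mem _ (pow_mem (sub_mem (hq 1) (hq 0)) 4) _))
      (add_mem (Subalgebra.smul_mem _ (pow_mem (sub_mem (hq 0) (hq (-1))) 2) _)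
        (Subalgebra.smul_mem _ (pow_mem (sub_mem (hq 0) (hq (-1))) 4) _))) _)

/-! ## Locality and polynomial Lipschitz moduli of local polynomials -/

/-- **Part F-P of stub F (registered helper): every local polynomial reads a box and is
polynomially Lipschitz there, with a polynomial growth bound.** For `u ∈ 𝒫` there are `k`, `C ≥ 0`,
`d` with `u` depending only on the sites of `[-k, k]` and, whenever the coordinates of `σ'` on
`[-k, k]` are bounded by `R ≥ 1` and those of `σ` are within `δ ∈ [0, 1]` of them,
`|u σ - u σ'| ≤ C R^d δ` and `|u σ'| ≤ C R^d` (structural induction: coordinates `(1, 1)`,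
constants `(|r|, 0)`, sums `(C₁ + C₂, d₁ + d₂)`, products `(3C₁C₂, d₁ + d₂)`). [folklore] -/
theorem pencilFramework_polynomials : ∀ u ∈ Algebra.adjoin ℝ (Set.range fun xc : ℤ × Bool => fun σ : Literature.MathematicalPhysics.KineticTheory.HeatConduction.ChainConfig => if xc.2 then (σ xc.1).2 else (σ xc.1).1), ∃ (k : ℕ) (C : ℝ) (d : ℕ), 0 ≤ C ∧ DependsOn u (Set.Icc (-(k : ℤ)) k) ∧ ∀ (σ σ' : Literature.MathematicalPhysics.KineticTheory.HeatConduction.ChainConfig) (R δ : ℝ), 1 ≤ R → 0 ≤ δ → δ ≤ 1 → (∀ i : ℤ, -(k : ℤ) ≤ i → i ≤ k → |(σ' i).1| ≤ R ∧ |(σ' i).2| ≤ R ∧ |(σ i).1 - (σ' i).1| ≤ δ ∧ |(σ i).2 - (σ' i).2| ≤ δ) → |u σ - u σ'| ≤ C * R ^ d * δ ∧ |u σ'| ≤ C * R ^ d := by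
  intro u hu
  induction hu using Algebra.adjoin_induction with
  | mem f hf =>
    obtain ⟨⟨x, b⟩, rfl⟩ := hf
    refine ⟨x.natAbs, 1, 1, zero_le_one, ?_, ?_⟩
    · intro σ σ' h
      have hx : σ x = σ' x := h x (by simp only [mem_Icc]; omega)
      simp only [hx]
    · intro σ σ' R δ hR hδ0 _ h
      obtain ⟨h1, h2, h3, h4⟩ := h x (by omega) (by omega)
      have hRδ : δ ≤ 1 * R ^ 1 * δ := by rw [one_mul, pow_one]; nlinarith
      cases b
      · simp only [Bool.false_eq_true, if_false]
        exact ⟨h3.trans hRδ, by rw [one_mul, pow_one]; exact h1⟩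
      · simp only [if_true]
        exact ⟨h4.trans hRδ, by rw [one_mul, pow_one]; exact h2⟩
  | algebraMap r =>
    have hr : (algebraMap ℝ (ChainConfig → ℝ) r) = fun _ => r := rfl
    rw [hr]
    refine ⟨0, |r|, 0, abs_nonneg r, fun σ σ' _ => rfl, ?_⟩
    intro σ σ' R δ _ hδ0 _ _
    refine ⟨?_, by rw [pow_zero, mul_one]⟩
    rw [sub_self, abs_zero, pow_zero, mul_one]
    positivity
  | add f₁ f₂ _ _ ih₁ ih₂ =>
    obtain ⟨k₁, C₁, d₁, hC₁, hdep₁, h₁⟩ := ih₁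
    obtain ⟨k₂, C₂, d₂, hC₂, hdep₂, h₂⟩ := ih₂
    refine ⟨max k₁ k₂, C₁ + C₂, d₁ + d₂, add_nonneg hC₁ hC₂, ?_, ?_⟩
    · intro σ σ' h
      simp only [Pi.add_apply]
      rw [hdep₁ fun i hi => h i ?_, hdep₂ fun i hi => h i ?_]
      · simp only [mem_Icc] at hi ⊢; omega
      · simp only [mem_Icc] at hi ⊢; omega
    · intro σ σ' R δ hR hδ0 hδ1 h
      obtain ⟨hl₁, hg₁⟩ := h₁ σ σ' R δ hR hδ0 hδ1 fun i hi1 hi2 => h i (by omega) (by omega)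
      obtain ⟨hl₂, hg₂⟩ := h₂ σ σ' R δ hR hδ0 hδ1 fun i hi1 hi2 => h i (by omega) (by omega)
      have hp₁ : R ^ d₁ ≤ R ^ (d₁ + d₂) := pow_le_pow_right₀ hR (Nat.le_add_right _ _)
      have hp₂ : R ^ d₂ ≤ R ^ (d₁ + d₂) := pow_le_pow_right₀ hR (Nat.le_add_left _ _)
      have e₁ : C₁ * R ^ d₁ ≤ C₁ * R ^ (d₁ + d₂) := mul_le_mul_of_nonneg_left hp₁ hC₁
      have e₂ : C₂ * R ^ d₂ ≤ C₂ * R ^ (d₁ + d₂) := mul_le_mul_of_nonneg_left hp₂ hC₂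
      simp only [Pi.add_apply]
      constructor
      · calc |f₁ σ + f₂ σ - (f₁ σ' + f₂ σ')| = |(f₁ σ - f₁ σ') + (f₂ σ - f₂ σ')| := by ring_nf
          _ ≤ |f₁ σ - f₁ σ'| + |f₂ σ - f₂ σ'| := abs_add_le _ _
          _ ≤ C₁ * R ^ d₁ * δ + C₂ * R ^ d₂ * δ := add_le_add hl₁ hl₂
          _ ≤ C₁ * R ^ (d₁ + d₂) * δ + C₂ * R ^ (d₁ + d₂) * δ :=
              add_le_add (mul_le_mul_of_nonneg_right e₁ hδ0) (mul_le_mul_of_nonneg_right e₂ hδ0)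
          _ = (C₁ + C₂) * R ^ (d₁ + d₂) * δ := by ring
      · calc |f₁ σ' + f₂ σ'| ≤ |f₁ σ'| + |f₂ σ'| := abs_add_le _ _
          _ ≤ C₁ * R ^ d₁ + C₂ * R ^ d₂ := add_le_add hg₁ hg₂
          _ ≤ C₁ * R ^ (d₁ + d₂) + C₂ * R ^ (d₁ + d₂) := add_le_add e₁ e₂
          _ = (C₁ + C₂) * R ^ (d₁ + d₂) := by ring
  | mul f₁ f₂ _ _ ih₁ ih₂ =>
    obtain ⟨k₁, C₁, d₁, hC₁, hdep₁, h₁⟩ := ih₁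
    obtain ⟨k₂, C₂, d₂, hC₂, hdep₂, h₂⟩ := ih₂
    refine ⟨max k₁ k₂, 3 * C₁ * C₂, d₁ + d₂, by positivity, ?_, ?_⟩
    · intro σ σ' h
      simp only [Pi.mul_apply]
      rw [hdep₁ fun i hi => h i ?_, hdep₂ fun i hi => h i ?_]
      · simp only [mem_Icc] at hi ⊢; omega
      · simp only [mem_Icc] at hi ⊢; omega
    · intro σ σ' R δ hR hδ0 hδ1 h
      obtain ⟨hl₁, hg₁⟩ := h₁ σ σ' R δ hR hδ0 hδ1 fun i hi1 hi2 => h i (by omega) (by omega)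
      obtain ⟨hl₂, hg₂⟩ := h₂ σ σ' R δ hR hδ0 hδ1 fun i hi1 hi2 => h i (by omega) (by omega)
      have hR0 : 0 ≤ R := zero_le_one.trans hR
      have hX₁ : 0 ≤ C₁ * R ^ d₁ := by positivity
      have hX₂ : 0 ≤ C₂ * R ^ d₂ := by positivity
      have hu₁ : |f₁ σ| ≤ 2 * (C₁ * R ^ d₁) := by
        have : |f₁ σ| ≤ |f₁ σ'| + |f₁ σ - f₁ σ'| := by
          have := abs_add_le (f₁ σ') (f₁ σ - f₁ σ'); rw [add_sub_cancel] at this; exact this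
        have h3 : C₁ * R ^ d₁ * δ ≤ C₁ * R ^ d₁ := by nlinarith
        linarith
      simp only [Pi.mul_apply]
      constructor
      · calc |f₁ σ * f₂ σ - f₁ σ' * f₂ σ'| = |f₁ σ * (f₂ σ - f₂ σ') + (f₁ σ - f₁ σ') * f₂ σ'| := by
              ring_nf
          _ ≤ |f₁ σ * (f₂ σ - f₂ σ')| + |(f₁ σ - f₁ σ') * f₂ σ'| := abs_add_le _ _
          _ = |f₁ σ| * |f₂ σ - f₂ σ'| + |f₁ σ - f₁ σ'| * |f₂ σ'| := by rw [abs_mul, abs_mul]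
          _ ≤ 2 * (C₁ * R ^ d₁) * (C₂ * R ^ d₂ * δ) + C₁ * R ^ d₁ * δ * (C₂ * R ^ d₂) :=
              add_le_add (mul_le_mul hu₁ hl₂ (abs_nonneg _) (by positivity))
                (mul_le_mul hl₁ hg₂ (abs_nonneg _) (by positivity))
          _ = 3 * C₁ * C₂ * R ^ (d₁ + d₂) * δ := by rw [pow_add]; ring
      · calc |f₁ σ' * f₂ σ'| = |f₁ σ'| * |f₂ σ'| := abs_mul _ _
          _ ≤ C₁ * R ^ d₁ * (C₂ * R ^ d₂) := mul_le_mul hg₁ hg₂ (abs_nonneg _) hX₁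
          _ = C₁ * C₂ * R ^ (d₁ + d₂) := by rw [pow_add]; ring
          _ ≤ 3 * C₁ * C₂ * R ^ (d₁ + d₂) := by
              have : 0 ≤ C₁ * C₂ * R ^ (d₁ + d₂) := by positivity
              nlinarith

/-! ## Orbits and moments -/

/-- `t ↦ u(φ_t σ)` is continuous for `u ∈ 𝒫` and `σ` in the carrier (it is differentiable,
`hasDerivAt_comp_flow_of_mem_localPolynomials`). [folklore] -/
theorem continuous_comp_flow_of_mem_polyObs {P : OscillatorChain} (D : InfiniteChainDynamics P)
    {u : ChainConfig → ℝ}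
    (hu : u ∈ Algebra.adjoin ℝ (Set.range fun xc : ℤ × Bool => fun σ : ChainConfig =>
      if xc.2 then (σ xc.1).2 else (σ xc.1).1))
    {σ : ChainConfig} (hσ : σ ∈ D.carrier) : Continuous fun t : ℝ => u (D.flow t σ) :=
  continuous_iff_continuousAt.2 fun t =>
    (hasDerivAt_comp_flow_of_mem_localPolynomials D hu hσ t).continuousAt

/-- **Moments of local polynomials under a shift-invariant thermal state** of
`pinnedChain ω₂ lam β γ` (`ω₂ > 0`, `lam, β ≥ 0`, `T > 0`): every `u ∈ 𝒫` is measurable, square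
integrable, with `u⁴ ∈ L¹(μ)`. [folklore] -/
theorem moments_of_mem_polyObs {ω₂ lam β : ℝ} (γ : ℝ) (hω : 0 < ω₂) (hl : 0 ≤ lam) (hβ : 0 ≤ β)
    {T : ℝ} (hT : 0 < T) {μ : Measure ChainConfig}
    (hμ : (pinnedChain ω₂ lam β γ).IsChainGibbsMeasure T μ) (hS : IsShiftInvariant μ)
    {u : ChainConfig → ℝ}
    (hu : u ∈ Algebra.adjoin ℝ (Set.range fun xc : ℤ × Bool => fun σ : ChainConfig =>
      if xc.2 then (σ xc.1).2 else (σ xc.1).1)) :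
    Measurable u ∧ MemLp u 2 μ ∧ Integrable (fun σ => u σ ^ 4) μ := by
  obtain ⟨hm, hint⟩ := measurable_and_integrable_pow_of_mem_polyObs γ hω hl hβ hT hμ hS hu
  refine ⟨hm, ?_, ?_⟩
  · rw [memLp_two_iff_integrable_sq hm.aestronglyMeasurable]
    refine (hint 2).congr (Eventually.of_forall fun σ => ?_)
    simp only [sq_abs]
  · refine (hint 4).congr (Eventually.of_forall fun σ => ?_)
    exact Even.pow_abs (by decide) _

end Summit.AtomisticToContinuum.FouriersLaw.Theorems.DrudeDissolution.GramPencilHarmonicChaos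

end
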